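import Summits.QuantumFields.YangMills.Theorems.BalabanLadderNTClassicalShadowOrbitThree
import Summits.QuantumFields.YangMills.Theorems.BalabanLadderNTClassicalShadowBoundaryLayer
import HarnessLib

/-!
# Crux `NT` (stmt-QuantumFields-19353), stub `stub_refpkgT : RefPkgT`: THE CLASSICAL SHADOW, XII — the clause-3 orbit test on the BOUNDARY LAYER

Helper file (`--supports stmt-QuantumFields-19353`) of the fleet lead prover of crux `NT` (unit `ym-spine-19353-p1`, GEN 15); sequel of
`…ClassicalShadowOrbitThree` (p605033: `orbitK3_le_of_e3osc`, depth `≥ 2`) and `…ClassicalShadowBoundaryLayer` (p609347: `tendsto_kerK3_one_all`).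

**`orbitK3_le_of_e3osc_depthOne`** — clause 3 of the registered package (`1 ≤ depth`) prices a one-orbit degenerate box by the orbit THIRD CUMULANT of
its density field at ANY three cube sites: `|κ₃,Γ(x,y,z)| ≤ C₃ / min(d)⁴ / (1 + min(‖y−x‖,‖z−y‖,‖z−x‖))⁸`, i.e. `C₃ ≥ min d⁴ (1 + min sep)⁸ |κ₃,Γ|`.
NUMBERS (memo SIZING-19353-g15 §2(f), kit j302980 on the lowest states of j301533–j301540, SU(2) fundamental): `na` b = 6: depth ≥ 2 floor 116–163
(`|κ₃,Γ| ≈ 1–2·10⁻⁵` at min separation 4.2), depth ≥ 1 floor **0.85–1.0·10⁶** (`|κ₃,Γ| ≈ 0.13–0.20` on the boundary layer at min separation 5.7–6.2,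
weight (1+s)⁸ ≈ 4–7·10⁶): the eighth-power envelope of clause 3 makes boundary-layer symmetry breaking two to three orders of magnitude more expensive than
clause 2's.  Hypotheses (kernel symmetry, one orbit) as in `…ClassicalShadowOrbit[Three]`; nothing asserted about any exterior; not NT; not Clay.
-/

set_option autoImplicit false

noncomputable section

open MeasureTheory Filter Topology
open Literature.MathematicalPhysics.QuantumFieldTheory Literature.MathematicalPhysics.QuantumLattice
open Literature.Probability.LatticeModels
open Summit.QuantumFields.YangMills.Cruxes.OSLegsFromFemtoAndGap.DlrCollarTransfer
open Summit.QuantumFields.YangMills.Cruxes.UVSeamRec.BoundaryLawPenetration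

namespace Summit.QuantumFields.YangMills.Cruxes.NT.ClassicalShadow

variable {G : Type} [Group G] [TopologicalSpace G] [IsTopologicalGroup G] [CompactSpace G]
  [MeasurableSpace G] [BorelSpace G] (r : LatticeRep G)

section Price

variable (a : ℝ → ℝ) {ι : Type} [Fintype ι] [Nonempty ι]

/-- **Orbit test at `1 ≤ depth`, clause 3: a one-orbit degenerate box is priced by the orbit third cumulant of its density field at ANY three cube sites**, boundary layer included:
`|κ₃,Γ| ≤ C₃ / min(d_x,d_y,d_z)⁴ / (1 + min(‖y−x‖,‖z−y‖,‖z−x‖))⁸`. [folklore] -/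
theorem orbitK3_le_of_e3osc_depthOne (ha0 : Tendsto a atTop (𝓝 0)) {C₃ ℓ : ℝ} (hℓ : 0 < ℓ)
    (hE3 : ∃ β₃ : ℝ, ∀ β : ℝ, β₃ ≤ β → ∀ (c : Fin 4 → ℤ) (b : ℕ), (b : ℝ) * a β ≤ ℓ →
      ∀ (η η' : LGConfig 4 G) (x y z : Fin 4 → ℤ), 1 ≤ depth c b x → 1 ≤ depth c b y → 1 ≤ depth c b z →
        |kerK3 G r β c b η x y z - kerK3 G r β c b η' x y z| ≤
          C₃ / ((min (min (depth c b x) (depth c b y)) (depth c b z) : ℕ) : ℝ) ^ 4 /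
            (1 + min (min ‖siteToE (y - x)‖ ‖siteToE (z - y)‖) ‖siteToE (z - x)‖) ^ 8)
    (c : Fin 4 → ℤ) (b : ℕ) (η : LGConfig 4 G) (γ : ι → LGConfig 4 G → LGConfig 4 G) (hγ : ∀ i, Continuous (γ i))
    {x y z : Fin 4 → ℤ} (hx : 1 ≤ depth c b x) (hy : 1 ≤ depth c b y) (hz : 1 ≤ depth c b z)
    {M₁ M₂ M₃ M₁₂ M₁₃ M₂₃ M₁₂₃ : ℝ}
    (h₁ : ∀ ζ ∈ cubeMinimisers G r c b η, ∑ i, dens G r x (γ i (glueWith (cubeEdges c b) ζ η)) = M₁)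
    (h₂ : ∀ ζ ∈ cubeMinimisers G r c b η, ∑ i, dens G r y (γ i (glueWith (cubeEdges c b) ζ η)) = M₂)
    (h₃ : ∀ ζ ∈ cubeMinimisers G r c b η, ∑ i, dens G r z (γ i (glueWith (cubeEdges c b) ζ η)) = M₃)
    (h₁₂ : ∀ ζ ∈ cubeMinimisers G r c b η,
      ∑ i, dens G r x (γ i (glueWith (cubeEdges c b) ζ η)) * dens G r y (γ i (glueWith (cubeEdges c b) ζ η)) = M₁₂)
    (h₁₃ : ∀ ζ ∈ cubeMinimisers G r c b η,
      ∑ i, dens G r x (γ i (glueWith (cubeEdges c b) ζ η)) * dens G r z (γ i (glueWith (cubeEdges c b) ζ η)) = M₁₃)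
    (h₂₃ : ∀ ζ ∈ cubeMinimisers G r c b η,
      ∑ i, dens G r y (γ i (glueWith (cubeEdges c b) ζ η)) * dens G r z (γ i (glueWith (cubeEdges c b) ζ η)) = M₂₃)
    (h₁₂₃ : ∀ ζ ∈ cubeMinimisers G r c b η,
      ∑ i, dens G r x (γ i (glueWith (cubeEdges c b) ζ η)) * dens G r y (γ i (glueWith (cubeEdges c b) ζ η)) *
        dens G r z (γ i (glueWith (cubeEdges c b) ζ η)) = M₁₂₃)
    (s₁ : ∀ (β : ℝ) (i : ι), kerE G r β c b η (dens G r x ∘ γ i) = kerE G r β c b η (dens G r x))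
    (s₂ : ∀ (β : ℝ) (i : ι), kerE G r β c b η (dens G r y ∘ γ i) = kerE G r β c b η (dens G r y))
    (s₃ : ∀ (β : ℝ) (i : ι), kerE G r β c b η (dens G r z ∘ γ i) = kerE G r β c b η (dens G r z))
    (s₁₂ : ∀ (β : ℝ) (i : ι), kerE G r β c b η ((fun U => dens G r x U * dens G r y U) ∘ γ i) =
      kerE G r β c b η (fun U => dens G r x U * dens G r y U))
    (s₁₃ : ∀ (β : ℝ) (i : ι), kerE G r β c b η ((fun U => dens G r x U * dens G r z U) ∘ γ i) =
      kerE G r β c b η (fun U => dens G r x U * dens G r z U))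
    (s₂₃ : ∀ (β : ℝ) (i : ι), kerE G r β c b η ((fun U => dens G r y U * dens G r z U) ∘ γ i) =
      kerE G r β c b η (fun U => dens G r y U * dens G r z U))
    (s₁₂₃ : ∀ (β : ℝ) (i : ι), kerE G r β c b η ((fun U => dens G r x U * dens G r y U * dens G r z U) ∘ γ i) =
      kerE G r β c b η (fun U => dens G r x U * dens G r y U * dens G r z U)) :
    |M₁₂₃ / Fintype.card ι - M₁ / Fintype.card ι * (M₂₃ / Fintype.card ι) - M₂ / Fintype.card ι * (M₁₃ / Fintype.card ι) -
        M₃ / Fintype.card ι * (M₁₂ / Fintype.card ι) +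
        2 * (M₁ / Fintype.card ι * (M₂ / Fintype.card ι) * (M₃ / Fintype.card ι))| ≤
      C₃ / ((min (min (depth c b x) (depth c b y)) (depth c b z) : ℕ) : ℝ) ^ 4 /
        (1 + min (min ‖siteToE (y - x)‖ ‖siteToE (z - y)‖) ‖siteToE (z - x)‖) ^ 8 := by
  obtain ⟨β₃, H3⟩ := hE3
  have hlim : Tendsto (fun β : ℝ => |kerK3 G r β c b η x y z - kerK3 G r β c b 1 x y z|) atTop
      (𝓝 |M₁₂₃ / Fintype.card ι - M₁ / Fintype.card ι * (M₂₃ / Fintype.card ι) - M₂ / Fintype.card ι * (M₁₃ / Fintype.card ι) -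
        M₃ / Fintype.card ι * (M₁₂ / Fintype.card ι) +
        2 * (M₁ / Fintype.card ι * (M₂ / Fintype.card ι) * (M₃ / Fintype.card ι))|) := by
    have h := ((tendsto_kerK3_of_orbit r c b η γ hγ h₁ h₂ h₃ h₁₂ h₁₃ h₂₃ h₁₂₃ s₁ s₂ s₃ s₁₂ s₁₃ s₂₃ s₁₂₃).sub
      (tendsto_kerK3_one_all r c b x y z)).abs
    rwa [sub_zero] at h
  refine le_of_tendsto hlim ?_
  filter_upwards [eventually_mul_le_of_tendsto_zero ha0 hℓ b, eventually_ge_atTop β₃] with β hb hβ3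
  exact H3 β hβ3 c b hb η 1 x y z hx hy hz

end Price

end Summit.QuantumFields.YangMills.Cruxes.NT.ClassicalShadow

end
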